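import Literature.AnabelianGeometry.SemiGraphs.FreeProPTwoEstrangementByAbelianisation
import Literature.AnabelianGeometry.SemiGraphs.FreeProPRankTwo
import Literature.GroupTheory.ProcyclicImageBridges
import HarnessLib

/-!
# `𝒢_θ`: the (H3) CROSS term `hcross` — producer in the binder shape of brick R5, at brick R1's group
# (FRONTIER programme «REFUTE-F1732», R7-hcross-glue)

Mochizuki, *Semi-graphs of anabelioids*, Publ. RIMS **42** (2006), Def. 2.4 (iv) p. 26 («estranged», cross
case `b′ ≠ b`) [cite: MochizukiSemiAnbd2006, Def 2.4(iv) p.26]; Thm 3.7 p. 40 (hypothesis «totally estranged»).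

abc-iut cell, layer L3, FRONTIER programme `plan/L3/SUBDAG-SemiAnbd-Thm37iii-REFUTE.md` (erratum-grade;
honest framing α59: towards a kernel erratum for the ∀-countable reading of [SemiAnbd] Thm 3.7 (iii); desk
countermodel `𝒢_θ` by abc-iut-L3-d1 g3, memo sha16 8b26b5199c29f55f; print proves finite `𝔾`, kernel p431007).
PROOF-ONLY glue (seat abc-iut-w6-d096, α79 «R7-hcross-glue»; 0 definitions, 0 named facts) between

* brick R2b (`FreeProPTwoEstrangementByAbelianisation.lean`: cross-estrangement by abelianisation, binder `hinj`
  discharged from a `ℤ_p`-exponential),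
* abc-iut-L3-t7's bridge `MonoidHom.range_eq_topologicalClosure_zpowers_padicInt` (`ProcyclicImageBridges.lean`:
  `range α = cl⟨α 1⟩` for every continuous `α : ℤ_p → G`), and
* brick R1 part 1 (`FreeProPRankTwo.lean`, abc-iut-w6-d019: `Grp p`, `ab p`, `a p`, `b p`, `ab_a`, `ab_b`),

producing the binder `hcross` of brick R5's
`ProfiniteSemiGraph.thetaRayOfTwists_isTotallyEstranged_and_isTotallyAloof` (abc-iut-w6-d102, `ThetaRayEstranged.lean`):

  `∀ (k : ℕ) (g : ConjAct G), cl⟨α e⟩ ⊓ g • cl⟨θ (n (k+1)) (α e)⟩ = ⊥`   (`e = ofAdd 1`),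

in BINDER form over the gluing `α : Multiplicative ℤ_[p] →ₜ* G` and the twists `θ m : G →ₜ* G` (bricks R1c / R1
part 2 supply `α p`, `θ p m`), from ONLY the abelianisation equations `ab (α 1) = (1,0)` and
`ab (θ m (α 1)) = (1, d_m)` with `d_m ≠ 0` (for `𝒢_θ`: `d_m = p^m`):

* `inf_conj_topologicalClosure_zpowers_eq_bot_of_padicInt_exponential` — generic `G`: `cl⟨α 1⟩ ⊓ g • cl⟨c⟩ = ⊥`
  whenever `ab (α 1) = (1,0)`, `ab c = (1,d)`, `d ≠ 0` (no `hinj`, no `hrange` binder left);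
* `hcross_of_abelianisation` — generic `G`: the displayed `hcross` from `ab ∘ θ_m ∘ α (1) = (1, d_m)`, `d_m ≠ 0`;
* `FreeProPRankTwo.hcross_of_ab_theta` — at R1's `Grp p` / `ab p` / `a p`: from `α (ofAdd 1) = a p` and
  `ab p (θ m (a p)) = ofAdd (1, p^m)`; `FreeProPRankTwo.hcross_of_theta_a` — the same from the element equation
  `θ m (a p) = a p * b p ^ (p ^ m)`.

No side taken on [IUTchIII] Cor. 3.12; nothing here asserts or refutes abc; typed ≠ proved.
-/

open scoped Pointwise

namespace Literature.AnabelianGeometry.SemiGraphs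

namespace FreeProPTwo

section Generic

variable (p : ℕ) [Fact p.Prime] {G : Type*} [Group G] [TopologicalSpace G] [IsTopologicalGroup G] [T2Space G]

/-- **Cross-estrangement from a `ℤ_p`-exponential, no binder left**: for a continuous `ab : G → ℤ_p × ℤ_p`, a
continuous `α : ℤ_p → G` with `ab (α 1) = (1, 0)`, and `c ∈ G` with `ab c = (1, d)`, `d ≠ 0`:
`cl⟨α 1⟩ ⊓ g • cl⟨c⟩ = ⊥` for every `g : ConjAct G` ([SemiAnbd] Def. 2.4 (iv), cross case; R2b +
`range α = cl⟨α 1⟩`). [cite: MochizukiSemiAnbd2006, Def 2.4(iv) p.26] -/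
theorem inf_conj_topologicalClosure_zpowers_eq_bot_of_padicInt_exponential
    (ab : G →* Multiplicative (ℤ_[p] × ℤ_[p])) (hab : Continuous ab) (α : Multiplicative ℤ_[p] →* G)
    (hα : Continuous α) (ha : (ab (α (Multiplicative.ofAdd 1))).toAdd = (1, 0)) {c : G} {d : ℤ_[p]}
    (hd : d ≠ 0) (hc : (ab c).toAdd = (1, d)) (g : ConjAct G) :
    (Subgroup.zpowers (α (Multiplicative.ofAdd 1))).topologicalClosure ⊓
        g • (Subgroup.zpowers c).topologicalClosure = ⊥ :=
  inf_conj_topologicalClosure_zpowers_eq_bot_of_character ab hab hd ha hc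
    (PadicInt.eq_one_of_mem_topologicalClosure_zpowers_of_map_eq_one p ab hab ha α hα rfl
      (MonoidHom.range_eq_topologicalClosure_zpowers_padicInt α hα).ge) g

/-- **The binder `hcross` of R5's `thetaRayOfTwists_isTotallyEstranged_and_isTotallyAloof`, from the abelianisation
alone**: with `e := ofAdd 1`, gluing `α`, twists `θ m`, exponent sequence `n`, if `ab (α e) = (1,0)` and
`ab (θ m (α e)) = (1, d_m)` with `d_m ≠ 0` for every `m`, then
`∀ k g, cl⟨α e⟩ ⊓ g • cl⟨θ (n (k+1)) (α e)⟩ = ⊥`. [cite: MochizukiSemiAnbd2006, Def 2.4(iv) p.26] -/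
theorem hcross_of_abelianisation (ab : G →* Multiplicative (ℤ_[p] × ℤ_[p])) (hab : Continuous ab)
    (α : Multiplicative ℤ_[p] →ₜ* G) (θ : ℕ → (G →ₜ* G)) (n : ℕ → ℕ)
    (ha : (ab (α (Multiplicative.ofAdd 1))).toAdd = (1, 0))
    (hθ : ∀ m, ∃ d : ℤ_[p], d ≠ 0 ∧ (ab (θ m (α (Multiplicative.ofAdd 1)))).toAdd = (1, d)) :
    ∀ (k : ℕ) (g : ConjAct G),
      (Subgroup.zpowers (α (Multiplicative.ofAdd 1))).topologicalClosure ⊓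
        g • (Subgroup.zpowers (θ (n (k + 1)) (α (Multiplicative.ofAdd 1)))).topologicalClosure = ⊥ := by
  intro k g
  obtain ⟨d, hd, hc⟩ := hθ (n (k + 1))
  exact inf_conj_topologicalClosure_zpowers_eq_bot_of_padicInt_exponential p ab hab α.toMonoidHom
    α.continuous ha hd hc g

end Generic

end FreeProPTwo

/-! ### At brick R1's free pro-`p` group of rank two -/

namespace FreeProPRankTwo

variable (p : ℕ) [Fact p.Prime]

/-- `ab p (a p) = (1, 0)` in the additive spelling R2b consumes. [cite: MochizukiSemiAnbd2006, Def 2.4(iv) p.26] -/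
theorem toAdd_ab_a : ((ab p).toMonoidHom (a p)).toAdd = (1, 0) := by
  change Multiplicative.toAdd (ab p (a p)) = _
  rw [ab_a]
  rfl

/-- `ab p (b p) = (0, 1)` in the additive spelling R2b consumes. [cite: MochizukiSemiAnbd2006, Def 2.4(iv) p.26] -/
theorem toAdd_ab_b : ((ab p).toMonoidHom (b p)).toAdd = (0, 1) := by
  change Multiplicative.toAdd (ab p (b p)) = _
  rw [ab_b]
  rfl

/-- `ab p (a p * b p ^ (p ^ m)) = (1, p^m)`. [cite: MochizukiSemiAnbd2006, Def 2.4(iv) p.26] -/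
theorem toAdd_ab_a_mul_b_pow (m : ℕ) :
    ((ab p).toMonoidHom (a p * b p ^ (p ^ m))).toAdd = (1, (p : ℤ_[p]) ^ m) := by
  rw [map_mul, map_pow, toAdd_mul, toAdd_pow, toAdd_ab_a, toAdd_ab_b, Prod.smul_mk, Prod.mk_add_mk]
  simp

/-- **`hcross` for `𝒢_θ` at R1's group, from the abelianised twist equation** `ab p (θ m (a p)) = ofAdd (1, p^m)`
(R1 part 2's `ab ∘ θ_m ∘ α` formula) and `α (ofAdd 1) = a p` (R1c): for every exponent sequence `n`,
`∀ k g, cl⟨α 1⟩ ⊓ g • cl⟨θ (n (k+1)) (α 1)⟩ = ⊥` — the binder of R5's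
`thetaRayOfTwists_isTotallyEstranged_and_isTotallyAloof` at `G := Grp p`, `E := ℤ_p`, `e := ofAdd 1`.
[cite: MochizukiSemiAnbd2006, Def 2.4(iv) p.26] -/
theorem hcross_of_ab_theta (α : Multiplicative ℤ_[p] →ₜ* Grp p) (hαa : α (Multiplicative.ofAdd 1) = a p)
    (θ : ℕ → (Grp p →ₜ* Grp p))
    (hθ : ∀ m, ab p (θ m (a p)) = Multiplicative.ofAdd ((1 : ℤ_[p]), (p : ℤ_[p]) ^ m)) (n : ℕ → ℕ) :
    ∀ (k : ℕ) (g : ConjAct (Grp p)),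
      (Subgroup.zpowers (α (Multiplicative.ofAdd 1))).topologicalClosure ⊓
        g • (Subgroup.zpowers (θ (n (k + 1)) (α (Multiplicative.ofAdd 1)))).topologicalClosure = ⊥ := by
  refine FreeProPTwo.hcross_of_abelianisation p (ab p).toMonoidHom (ab p).continuous α θ n ?_ ?_
  · rw [hαa]; exact toAdd_ab_a p
  · intro m
    refine ⟨(p : ℤ_[p]) ^ m, pow_ne_zero _ (Nat.cast_ne_zero.mpr (Fact.out : p.Prime).ne_zero), ?_⟩
    rw [hαa]
    change Multiplicative.toAdd (ab p (θ m (a p))) = _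
    rw [hθ]
    rfl

/-- **`hcross` for `𝒢_θ` at R1's group, from the element equation** `θ m (a p) = a p * b p ^ (p ^ m)` (R1 part 2's
twist on the generator) and `α (ofAdd 1) = a p`. [cite: MochizukiSemiAnbd2006, Def 2.4(iv) p.26] -/
theorem hcross_of_theta_a (α : Multiplicative ℤ_[p] →ₜ* Grp p) (hαa : α (Multiplicative.ofAdd 1) = a p)
    (θ : ℕ → (Grp p →ₜ* Grp p)) (hθ : ∀ m, θ m (a p) = a p * b p ^ (p ^ m)) (n : ℕ → ℕ) :
    ∀ (k : ℕ) (g : ConjAct (Grp p)),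
      (Subgroup.zpowers (α (Multiplicative.ofAdd 1))).topologicalClosure ⊓
        g • (Subgroup.zpowers (θ (n (k + 1)) (α (Multiplicative.ofAdd 1)))).topologicalClosure = ⊥ := by
  refine hcross_of_ab_theta p α hαa θ (fun m => ?_) n
  rw [hθ]
  exact Multiplicative.toAdd.injective ((toAdd_ab_a_mul_b_pow p m).trans (toAdd_ofAdd _).symm)

end FreeProPRankTwo

end Literature.AnabelianGeometry.SemiGraphs
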